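import Mathlib
import HarnessLib
import HarnessLib.Audit
import Summits.ValiantsHypothesis.Statement
import Literature.Computability.AlgebraicComplexity.SymmetricArithCircuit
import Literature.Computability.AlgebraicComplexity.ValiantClasses
import Literature.Computability.AlgebraicComplexity.StandardFamilies
import Literature.Computability.AlgebraicComplexity.ArithCircuit
import Literature.Computability.AlgebraicComplexity.ValiantConjectureEquivProofs
import Literature.Computability.AlgebraicComplexity.DawarWilsenach2025Thm71
import HarnessLib.Audit.Status.Attr

/-!
Route: SymmetryDial

# Route SymmetryDial — VP≠VNP from AGL-symmetric hardness of per plus a symmetric lift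

X = A ∧ B on the SYMMETRIC-CIRCUIT DIAL (decomp-valiant cycle 1, lens 1 «representation-theoretic
obstruction splitting», gen 2;
LADDER-Valiant rung 0 — nothing here proves VP ≠ VNP). The restricted model is
representation-theoretic: Dawar–Wilsenach symmetric
arithmetic circuits, i.e. circuits for per_n on which a prescribed permutation group H_n ≤ Sym_n
(acting diagonally x_ij ↦ x_{h i,h j})
acts by automorphisms; the dial is the group H. WINDOW INSTANCE H = AGL_d(F_2) acting on F_2^d = Fin
d → Fin 2, n = 2^d, |H| = n^{log₂ n+O(1)}.
A = SymHardAffine: no polynomial-size AGL_d(F_2)-symmetric circuit family computes per_{2^d}. B =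
SymLiftAffine (declared residual):
if per is p-computable then such a family exists. The node is an AND-node: S ⟺ A ∧ B (kernel
`summit_iff_split` in the lens Sketch,
modulo the provable-now plumbing aside `LabelledCircuitComplexity` for S ⟹ A; B ⟺ (A → S) kernel
`symLiftAffine_iff_residual`).
Both ends of the dial are theorems with opposite pieces: top H = Sym_n, A PROVED (Dawar–Wilsenach
Thm 7.1, tree `DawarWilsenach2025_thm71_holds`,
kernel `symHard_top`); bottom |H| ≤ poly, B PROVED by orbit averaging (kernel
`symLift_of_isPBounded_card`); the affine group at d = log₂ n is the
canonical rung where neither piece is decided.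
Lean: `Summit.ValiantsHypothesis.ValiantsHypothesis.Theses.SymmetryDial.SymHardAffine ∧
Summit.ValiantsHypothesis.ValiantsHypothesis.Theses.SymmetryDial.SymLiftAffine`

## Assembly
Pure logic through the tree equivalence `isPComputable_perPoly_complex_iff : IsPComputable per ↔ VP
ℂ = VNP ℂ`: assume VP ℂ = VNP ℂ,
get p-computability of per, apply B to obtain the polynomial AGL-symmetric family, contradict A. The
deciding theorem `closes` in glue.lean is exactly this.

Rationale: WHY THIS LINE. Mechanism: Dawar–Wilsenach prove exponential lower bounds for per against
Sym_n-symmetric circuits by (i) a support theorem (small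
orbits ⇒ small supports; under AGL every orbit is ≤ |AGL| = 2^{o(n)}, so the affine version must
start from SIZE: gate stabilisers of index ≤ size), (ii) translation to symmetric threshold
circuits, (iii) a counting-width / bijection-game lower bound via
CFI-type matrices (DawarWilsenach2025 Thm 7.1, 5.1, 3.x; survey Dawar2024; depth/homomorphism
refinements arXiv:2601.09343); all three
steps are statements about the permutation group, and (i) is a theorem about SMALL-INDEX SUBGROUPS
of Sym_n. Imported area: finite
permutation-group theory / finite model theory — for the affine group the analogue of (i) is the
structure of subgroups of index
2^{O(d)} in AGL_d(F_2) (parabolic / flag stabilisers), and (iii) becomes a bijection game relative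
to affine structure. What it does
that prior routes do not: ProofCarryingSymmetry / MonotoneRestoration ask RESTORATION of full Sym_n
symmetry for ALL invariant VP
families at quasi-polynomial cost (RestorationQP, negative lemma
`RestorationQP_false_of_ArithmeticCFI` in tree); here the lift B is
for per only, at polynomial cost, under a group of order n^{log n}, and the hardness piece A is a
genuinely weaker-than-S lower bound
with the DW machine as attack; PneNP/SymmetryBudget (closed) dialled Young subgroups on the Boolean
side, where canonisation collapses
the window — the arithmetic side has no canonisation and the affine group is not a Young subgroup.
No GCT/orbit-closure statement is
used: those are ≥ border-hard and never S-implied (gen-0 WsBorderSandwich verdict), which is why gen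
2 moved the lens to group symmetry
OF THE CIRCUIT rather than of the polynomial.

RANKED CRUXES. #2 SymHardAffine (crux) — [piece A · tag WEAKER (S ⟹ A kernel modulo the aside
`LabelledCircuitComplexity`: `symHardAffine_of_summit` — poly-size symmetric circuits are poly-size
circuits, reindex F_2^d ≃ Fin 2^d by `rename_perPoly_equiv` +
`complexity_rename_of_injective_holds`, pad per_n ≼ per_{2^{⌊log₂n⌋+1}} by
`complexity_perPoly_mono`; A ⟹ S NOT known: the only transfer is symmetrization, which costs
|AGL_d(F_2)| = n^{log₂ n+O(1)} per gate — quasi-polynomial, not polynomial) · leaf ATTACKABLE (DW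
transfer, RE-CUT: AGL-orbits are automatically ≤ |AGL| = 2^{o(n)}, so the orbit→support step is void
and the line is SIZE-based — (A1) subgroups of index ≤ 2^{O(d)} of AGL_d(F_2) contain the radical of
a bounded flag-let (parabolic dominance), (ii) threshold translation Thm 5.1 preserves stabilisers
and is group-generic in substance, (A2) an affine CFI / bijection-game bound with point/hyperplane
pebbles — the open step) · RUNG PROVED above it on the dial: H = Sym_n (`symHard_top`, kernel from
`DawarWilsenach2025_thm71_holds`); by `symHard_mono` A for any H ≥ AGL containing… (monotone in H) ·
distinct by construction from lenses 2–6 (hitting sets, debordering, product depth, planted KI,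
tame/multilinear) and from gen-0 (orbit closures)] For no polynomially bounded t does every d admit
an AGL_d(F_2)-symmetric labelled arithmetic circuit over ℂ (Dawar–Wilsenach Def. 3.6/3.7, group =
permutations of F_2^d preserving x+y+z, acting diagonally on the variables x_ij, i,j ∈ F_2^d) with
at most t(2^d) gates computing per over the index set F_2^d. [difficulty: L] (why it might fail:
False only together with VP = VNP (S ⟹ A, kernel). As a target it may be out of reach: AGL-orbits
are automatically 2^{o(n)} (Ryser's formula is AGL-symmetric), so DW's orbit→support step is void; a
SIZE-based affine support theorem and an affine CFI game are both unproved.) [DawarWilsenach2025,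
Dawar2024, Dawar2020, arXiv:2601.09343]
#3 SymLiftAffine (crux) — [piece B · tag DECLARED-RESIDUAL (B ⟺ (A → S), kernel
`symLiftAffine_iff_residual`; S ⟹ B vacuously, kernel `symLiftAffine_of_summit`) · UNDECIDED with
stated test: B is PROVED by any polynomial-cost symmetrization of circuits for per under a group of
order n^{Θ(log n)} (averaging gives only |H|·size = quasi-poly; a proof needs to exploit the
parabolic filtration of AGL_d(F_2), e.g. averaging over a chain of subgroups each of index poly(n));
B is REFUTED by ¬A-independent means only together with ¬S, so no unconditional refutation is
expected · leaf IDEA-NEEDED · RUNG PROVED below it on the dial: |H_n| ≤ poly(n)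
(`symLift_of_isPBounded_card`, kernel: `VpFamilyPiCircuit.exists_piCircuit_size_le` +
`PICircuit.exists_isSymmetric_of_rename_eval_eq`), e.g. AGL_k(F_q) with k fixed, n = q^k; by
`symLift_anti` B descends to subgroups · NOT an instance of the refuted RestorationQP shape (that
asks all Sym_n-invariant VP families, full Sym_n, qp cost; refuting witness = CFI-type invariant VP
family, which is not per)] If the permanent family is p-computable over ℂ then for some polynomially
bounded t every d admits an AGL_d(F_2)-symmetric labelled circuit with at most t(2^d) gates
computing per over F_2^d. [deps: SymHardAffine] [difficulty: open-problem] (why it might fail: It is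
the residual A → S: if VP = VNP, poly circuits for per need not symmetrize under a group of order
n^{log n} at poly cost — orbit averaging loses the factor |H|, and DW-type rigidity may forbid small
symmetric circuits even for easy polynomials.) [DawarWilsenach2025, HrubesTzameret2015,
Burgisser2000, arXiv:2601.09343]
#9 LabelledCircuitComplexity (support) — [aside · PROVABLE NOW · plumbing that makes S ⟹ A kernel
(`symHardAffine_of_summit` takes it as hypothesis)] A labelled (Dawar–Wilsenach, unbounded fan-in)
arithmetic circuit over ℂ with gate set G computing f at its output yields a fan-in-two
straight-line program for f of length ≤ |G|²: binarise each gate (a gate with m children costs ≤ m−1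
≤ |G| binary operations; inputs and constants are free operands). [difficulty: provable-now]
[Burgisser2000, DawarWilsenach2025]

TWO-LAYER PLAN. A ⇐ A₁ → A₂ → A (BC3 skeleton bc/SymHardAffine_birth.lean, rc 0, sorries = 2 stubs):
A₁ = `stub_affineSupportTranslation` = «SIZE-based affine
support theorem + stabiliser-preserving threshold translation: a poly-size AGL_d(F_2)-symmetric
circuit family for per yields, for every target set
S ⊆ ℂ, AGL-symmetric threshold circuits of ANY size whose gates are supported by flag-lets (P, Q) of
bounded size deciding per(A) ∈ S on 0/1 matrices»
(under AGL every orbit is ≤ |AGL| = 2^{o(n)}, so DW's orbit→support step is void; the content is: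
subgroups of index ≤ 2^{O(d)} of AGL_d(F_2) contain the
radical of a bounded flag-let — parabolic dominance), A₂ = `stub_affineGame` = «for some target
family S_d and every support bound c there is a d with NO
such threshold circuit» (affine bijection game / CFI relative to the ambient affine space — the open
heart). B ⇐ B₁ → B₂ → B (bc/SymLiftAffine_birth.lean,
rc 0, sorries = 2 stubs): B₁ = `stub_inductionFromGL` (PROVABLE: induce symmetry from GL_d(F_2) to
AGL_d(F_2) along the 2^d = n translation cosets —
orbit averaging generalised from the trivial subgroup to any subgroup of polynomial index), B₂ =
`stub_liftGL` (the residual transported to the linear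
group; IDEA-NEEDED). Splits are filed only when a crux is staffed (D-0019).

KILL CRITERIA. Refutation of A (an explicit poly-size AGL-symmetric family for per_{2^d}) closes the
route `refuted:SymHardAffine` AND proves B outright — the dial
then says the affine rung is below the window; pivot = move H up (e.g. AGL_d(F_2) ≀ structure or Sym
on a Grassmannian). A proof of ¬B is impossible
without ¬S∧A, so B is never killed alone. A proof of A by an argument that visibly gives A for EVERY
H of superpolynomial order would expose the
window as empty from above (then SymHard_H ⟺ "|H| superpoly" and the residual is summit-hard):
recorded as kill criterion «uniformity in H».
VP ≠ VNP proved elsewhere moots everything.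

NOT DECOMPOSED YET. The AGL support theorem (A₁), the threshold translation for subgroups, and the
affine CFI construction are layer-2 children, filed when a prover
takes A; the plumbing aside is provable now and deliberately not in the cone. No constants (the
exponent of t) are fixed: all statements are
`IsPBounded`-shaped (typing checklist 4c(iv)).

CHEAPEST FALSIFIER. Write Ryser's / Glynn's formula for per over F_2^d and check whether the affine
group acts on its terms with poly(2^d) orbits on PARTIAL products —
if some classical formula re-associates into an AGL-symmetric circuit of size poly(n) the crux A
dies in an afternoon. Done by hand for Ryser:
the subsets S ⊆ F_2^d form orbits of size up to n^{log n} (affine-independent sets), so the naive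
symmetric closure is quasi-polynomial, not
polynomial — A survives the cheapest check; the next check is the DW support theorem's proof (Thm
3.x) read with AGL in place of Sym_n.

NUMBERS. |AGL_d(F_2)| = 2^d ∏_{i<d}(2^d − 2^i) = n^{log₂ n + O(1)} with n = 2^d; DW: Sym_n-symmetric
circuits for per_n have size ≥ 2^{εn} infinitely
often (Thm 7.1); orbit averaging (tree `PICircuit.exists_isSymmetric_of_rename_eval_eq`): size ≤ |X|
+ (2|H|+1)·s + 5 — polynomial iff |H| ≤ poly;
smallest index of a proper subgroup of AGL_d(F_2) is 2^d − 1… (point/hyperplane stabilisers, index ≈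
n), the source of «affine supports».

DEFINITION REQUESTS. None: the affine group is inlined as `Subgroup.closure {σ | ∀ x y z, σ (x+y+z)
= σ x + σ y + σ z}` over `Fin d → Fin 2` (no transport); a
named `Literature` definition `affinePermGroup d` would shorten the items and is requested only if
the route is staffed.

Novelty: Searches (2026-08-29): lit search --hybrid "symmetric arithmetic circuits permanent lower bound
subgroup symmetry smaller group" (8 docs, none on
sub-symmetric groups); lit vsearch "lower bounds for arithmetic circuits symmetric under a proper
subgroup such as the affine group" (no relevant hit);
lit search --hybrid "symmetric circuits invariant under affine group AGL lower bound supports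
permanent" (8 generic textbook hits: landsberg2017 p184,
jukna2012, arora2009 — none on group-restricted symmetric circuits); lit galaxy search "symmetric
arithmetic circuit|symmetric circuits for|subspace-invariant"
--star all (1 relevant: [galaxy:pdf:-7663762923003831260] Rossman, Subspace-invariant AC⁰ formulas,
arXiv:1806.04831 — Boolean, translation subgroup
of AGL, parity); lit galaxy search "affine-invariant circuit|AGL-symmetric|affine symmetric
circuits" --star all (0 hits); lit galaxy search
"symmetric arithmetic circuits" --star pdf (0 hits); corpus reads
[corpus:paper-dawar2024-limits-symmetric-computation-invited-talk p5] (lower bounds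
so far only under LARGER symmetry groups), [corpus:paper-arxiv-2601.09343 p12] (Outlook: depth,
homomorphism counts — no subgroup question);
tree: `lean search IsSymmetric` (all symmetric-circuit theorems are for Sym_n or group-generic
closure lemmas; no AGL statement); ledger negatives
(32 refuted VH statements, none about symmetric circuits except RestorationQP's negative lemma,
addressed above).
Nearest prior art found: DawarWilsenach2025 (Thm  [refs: 1806.04831, paper-dawar2024-limits-symmetric-computation-invited-talk, paper-arxiv-2601.09343, DawarWilsenach2025]

Barriers (technique_class: symmetric-circuits, counting-width, orbit-averaging): - technique_class: symmetric-circuits, counting-width, orbit-averaging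
- Literature.Barriers.ValiantsHypothesis.MonotoneGap: the catalogued instance of «restricted-model
lower bounds do not transfer to general circuits»; the transfer here is EXACTLY the declared
residual B (symmetrization), typed and priced (|H| per gate), not assumed — A alone is never claimed
to give S; the bet is that the parabolic structure of AGL admits a cheaper-than-|H| symmetrization
for per specifically.
- Literature.Barriers.ValiantsHypothesis.AlgebraicNaturalProofs: outside — A is a lower bound
against a SYNTACTICALLY restricted class (H-symmetric circuits), proved DW-style by counting width /
bijection games on the circuit, not by a low-degree property of the coefficient vector of all small
circuits' outputs; the barrier does not quantify over symmetric-circuit size.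
- Literature.Barriers.ValiantsHypothesis.FullRankMultilinear: outside — counting width / supports /
bijection games are not (partial-derivative or flattening) RANK measures and no rank upper bound
caps them (DW reach 2^{Ω(n)} for per against Sym_n-symmetric circuits where rank methods cap
polynomially); noted because a prover tempted to attack A₂ by partial-derivative rank on
flag-let-supported gates would re-enter the rank barriers (FullRankMultilinear / rank lifting).
- Literature.Barriers.ValiantsHypothesis.GCTOccurrenceObstructions: not applicable — no
orbit-closure / obstruction statement is an item (that was gen 0's axis); the c

sub-problem: ValiantsHypothesis · status: draft · opened planner-decomp-val-lens-1-g2-0 2026-08-29T19:35:54Z · rev 1 · ledger route-ValiantsHypothesis-SymmetryDial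
GENERATED by the gate from the ledger (D-0016/17). Provers cite these decls: `theorem foo : Summit.ValiantsHypothesis.ValiantsHypothesis.Theses.SymmetryDial.<Decl> := …` in Summits/ValiantsHypothesis/ValiantsHypothesis/Theorems/<Name>.lean.
-/

namespace Summit.ValiantsHypothesis.ValiantsHypothesis.Theses.SymmetryDial

open scoped BigOperators Topology Manifold Classical MeasureTheory ProbabilityTheory Matrix InnerProductSpace ComplexConjugate ContinuousMap
open Filter Set Function TopologicalSpace MeasureTheory

attribute [summit_statement] _root_.ValiantsHypothesis

open Literature.PNP

/-- item stmt-ValiantsHypothesis-23680 · crux · rank 2 · SPLIT (gen 1) into AffineSupportTheorem, SymHardAffineSupported + glue SymHardAffineOfSupportSplit · direct attempts still welcome (low priority) · by planner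
why it might fail: False only together with VP = VNP (S ⟹ A, kernel). As a target it may be out of reach: AGL-orbits are automatically 2^{o(n)} (Ryser's formula is AGL-symmetric), so DW's orbit→support step is void; a SIZE-based affine support theorem and an affine CFI game are both unproved.
sources: DawarWilsenach2025, Dawar2024, Dawar2020, arXiv:2601.09343
[crux] [piece A · tag WEAKER (S ⟹ A kernel modulo the aside `LabelledCircuitComplexity`:
`symHardAffine_of_summit` — poly-size symmetric circuits are poly-size circuits, reindex F_2^d ≃ Fin
2^d by `rename_perPoly_equiv` + `complexity_rename_of_injective_holds`, pad per_n ≼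
per_{2^{⌊log₂n⌋+1}} by `complexity_perPoly_mono`; A ⟹ S NOT known: the only transfer is
symmetrization, which costs |AGL_d(F_2)| = n^{log₂ n+O(1)} per gate — quasi-polynomial, not
polynomial) · leaf ATTACKABLE (DW transfer, RE-CUT: AGL-orbits are automatically ≤ |AGL| = 2^{o(n)},
so the orbit→support step is void and the line is SIZE-based — (A1) subgroups of index ≤ 2^{O(d)} of
AGL_d(F_2) contain the radical of a bounded flag-let (parabolic dominance), (ii) threshold
translation Thm 5.1 preserves stabilisers and is group-generic in substance, (A2) an affine CFI /
bijection-game bound with point/hyperplane pebbles — the open step) · RUNG PROVED above it on the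
dial: H = Sym_n (`symHard_top`, kernel from `DawarWilsenach2025_thm71_holds`); by `symHard_mono` A
for any H ≥ AGL containing… (monotone in H) · distinct by construction from lenses 2–6 (hitting
sets, debordering, product depth, planted KI, tame/multilinear -/
@[route_item "route-ValiantsHypothesis-SymmetryDial", crux]
def SymHardAffine : Prop :=
  ¬ ∃ t : ℕ → ℕ, Literature.Computability.AlgebraicComplexity.IsPBounded t ∧ ∀ d : ℕ, ∃ (G : Type) (_ : Fintype G) (C : Literature.Computability.AlgebraicComplexity.LabelledArithCircuit ℂ ((Fin d → Fin 2) × (Fin d → Fin 2)) Unit G), C.IsSymmetric ↥(Subgroup.closure {σ : Equiv.Perm (Fin d → Fin 2) | ∀ x y z : Fin d → Fin 2, σ (x + y + z) = σ x + σ y + σ z}) ∧ C.eval (C.output ()) = Literature.Computability.AlgebraicComplexity.perPoly (Fin d → Fin 2) ℂ ∧ Fintype.card G ≤ t (2 ^ d)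

-- parent: SymHardAffine · child (gen 1)
/--     item stmt-ValiantsHypothesis-23710 · crux · rank 201 · open
    parent: SymHardAffine · by planner
    why it might fail: At q = 2 small-index subgroups can meet the unipotent radical in a twisted submodule (H¹(GL₃(2),𝔽₂³) ≠ 0; A₇ < A₈ ≅ GL₄(2): index-8 transitive exceptions at d = 3, 4); if twists compound along the parabolic recursion, |U| or codim W may have to grow with d for fixed c.
    sources: doi:10.1112/plms/s3-50.3.426, doi:10.1017/CBO9780511629235, arXiv:1311.6733, DawarWilsenach2025
[piece A₁ of the MECHANISM SPLIT of SymHardAffine (lens-1 g3) · PURE FINITE GROUP THEORY · tags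
UNDECIDED-with-test (GAP census of subgroup classes of AGL_d(𝔽₂), d ≤ 5, index ≤ n³: run by census
g5, job j335499 — every class contains a flag-let fixator, worst codimension s = 2/4/5 at d = 5 for
index ≤ n/n²/n³, the only non-parabolic phenomena being the classical accidents H¹(GL₃(2),𝔽₂³) ≠ 0
and A₇ < A₈ ≅ GL₄(2), each absorbed at bounded cost in higher d) · ATTACKABLE-NOW (first layer
PRINT: subgroups of GL_d(2) of index < 2^{cd} are reducible, Liebeck 1985 / Aschbacher classes,
census v4 T2; the bounded recursion through unipotent radicals + H¹ bookkeeping at q = 2 is NOT in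
print) · INSTRUMENTABLE] Affine support theorem: for every exponent c there is k such that for every
d every subgroup of AGL_d(𝔽₂) (permutations of 𝔽₂^d preserving x+y+z) of index ≤ (2^d)^c + c
contains Fix(U,W) = {σ : σ|_U = id ∧ ∀ v, σ v + v ∈ W} for some point set |U| ≤ k and additive
subgroup W of index ≤ 2^k (no nesting between U and W). It is the size-based replacement of
Dawar–Wilsenach's orbit→support step (void for AGL, whose orbits are automatically 2^{o(n)}).
[difficulty: M–L] -/
@[route_item "route-ValiantsHypothesis-SymmetryDial"]
def AffineSupportTheorem : Prop :=
  ∀ c : ℕ, ∃ k : ℕ, ∀ (d : ℕ) (K : Subgroup ↥(Subgroup.closure {σ : Equiv.Perm (Fin d → Fin 2) | ∀ x y z : Fin d → Fin 2, σ (x + y + z) = σ x + σ y + σ z})), K.index ≤ (2 ^ d) ^ c + c → ∃ (U : Finset (Fin d → Fin 2)) (W : AddSubgroup (Fin d → Fin 2)), U.card ≤ k ∧ W.index ≤ 2 ^ k ∧ ∀ σ : ↥(Subgroup.closure {σ : Equiv.Perm (Fin d → Fin 2) | ∀ x y z : Fin d → Fin 2, σ (x + y + z) = σ x + σ y + σ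 z}), (∀ u ∈ U, σ.1 u = u) → (∀ v : Fin d → Fin 2, σ.1 v + v ∈ W) → σ ∈ K

-- parent: SymHardAffine · child (gen 1)
/--     item stmt-ValiantsHypothesis-23711 · crux · rank 202 · open
    parent: SymHardAffine · by planner
    why it might fail: False only with VP = VNP (S ⟹ A ⟹ A₂ kernel). As a target: a Fix(U,W)-invariant gate sees 2^k cosets and k constants, so the counting lower bound must survive a built-in affine structure — CFI over an 𝔽₂-space base is where rank logic beats FPC; no affine bijection game in print.
    sources: DawarWilsenach2025, Dawar2024, arXiv:2601.09343, Dawar2020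
[piece A₂ of the MECHANISM SPLIT of SymHardAffine (lens-1 g3) · tags WEAKER (kernel: SymHardAffine →
SymHardAffineSupported, symHardAffineSupported_of_symHardAffine; hence S-implied) · the AFFINE CFI /
BIJECTION-GAME HEART · IDEA-NEEDED (no affine analogue of the CFI-matching construction DW Thm 7.2
with point/hyperplane pebbles exists; the threshold translation DW Thm 5.1 is group-generic) · BC5
witness: the Sym_n analogue is PROVED in the tree (DawarWilsenach2025_thm71_holds ⇒ symHard_top)]
For every support bound k: no polynomially bounded t admits, for every d, an AGL_d(𝔽₂)-symmetric
labelled arithmetic circuit over ℂ with ≤ t(2^d) gates computing per over 𝔽₂^d in which EVERY gate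
is k-supported (fixed, through some automorphism extension, by a flag-let fixator Fix(U,W) with |U|
≤ k, [𝔽₂^d : W] ≤ 2^k). Given A₁ the split is exact: SymHardAffine ↔ SymHardAffineSupported
(symHardAffine_iff_supported). [difficulty: research] -/
@[route_item "route-ValiantsHypothesis-SymmetryDial"]
def SymHardAffineSupported : Prop :=
  ∀ k : ℕ, ¬ ∃ t : ℕ → ℕ, Literature.Computability.AlgebraicComplexity.IsPBounded t ∧ ∀ d : ℕ, ∃ (G : Type) (_ : Fintype G) (C : Literature.Computability.AlgebraicComplexity.LabelledArithCircuit ℂ ((Fin d → Fin 2) × (Fin d → Fin 2)) Unit G), C.IsSymmetric ↥(Subgroup.closure {σ : Equiv.Perm (Fin d → Fin 2) | ∀ x y z : Fin d → Fin 2, σ (x + y + z) = σ x + σ y + σ z}) ∧ C.eval (C.output ()) = Literature.Computability.AlgebraicComplexity.perPoly (Fin d → Fin 2) ℂ ∧ Fintype.card G ≤ t (2 ^ d) ∧ ∀ g : G, ∃ (U : Finset (Fin d → Fin 2)) (W : AddSubgroup (Fin d → Fin 2)), U.card ≤ k ∧ W.index ≤ 2 ^ k ∧ ∀ σ : ↥(Subgroup.closure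 {σ : Equiv.Perm (Fin d → Fin 2) | ∀ x y z : Fin d → Fin 2, σ (x + y + z) = σ x + σ y + σ z}), (∀ u ∈ U, σ.1 u = u) → (∀ v : Fin d → Fin 2, σ.1 v + v ∈ W) → ∃ π : Equiv.Perm G, C.IsAutomorphismExtending σ π ∧ π g = g

-- parent: SymHardAffine · glue (gen 1)
/--     item stmt-ValiantsHypothesis-23712 · support · rank 203 · closed · proved by Summit.ValiantsHypothesis.ValiantsHypothesis.Theorems.SymmetryDialSupportSplit.symHardAffineOfSupportSplit_holds (planner)
    parent: SymHardAffine · GLUE: children ⟹ parent · by planner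
AffineSupportTheorem → SymHardAffineSupported → SymHardAffine by ORBIT–STABILISER: in a Γ-symmetric
labelled circuit the stabiliser in Γ of a gate (elements with some automorphism extension fixing the
gate) is a subgroup of index ≤ the number of gates (gateStab, index_gateStab_le), hence ≤ t(2^d) ≤
(2^d)^c + c; the affine support theorem then makes every gate k(c)-supported, and supported hardness
excludes the family. PROVED (kernel, 0 sorry) as symHardAffine_of_supportSplit in
decomp-val-lens-1/g3/SymmetryDialSupport.lean; to be landed as
Theorems/SymmetryDialSupportSplit.lean against the glue item. -/
@[route_item "route-ValiantsHypothesis-SymmetryDial"]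
def SymHardAffineOfSupportSplit : Prop :=
  AffineSupportTheorem → SymHardAffineSupported → SymHardAffine

-- `SymHardAffineOfSupportSplit` holds: proved by `Summit.ValiantsHypothesis.ValiantsHypothesis.Theorems.SymmetryDialSupportSplit.symHardAffineOfSupportSplit_holds` (its module imports this route file, so no `_holds` link can be stated here).

/-- item stmt-ValiantsHypothesis-23681 · crux · rank 3 · open · by planner
why it might fail: It is the residual A → S: if VP = VNP, poly circuits for per need not symmetrize under a group of order n^{log n} at poly cost — orbit averaging loses the factor |H|, and DW-type rigidity may forbid small symmetric circuits even for easy polynomials.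
sources: DawarWilsenach2025, HrubesTzameret2015, Burgisser2000, arXiv:2601.09343
[crux] [piece B · tag DECLARED-RESIDUAL (B ⟺ (A → S), kernel `symLiftAffine_iff_residual`; S ⟹ B
vacuously, kernel `symLiftAffine_of_summit`) · UNDECIDED with stated test: B is PROVED by any
polynomial-cost symmetrization of circuits for per under a group of order n^{Θ(log n)} (averaging
gives only |H|·size = quasi-poly; a proof needs to exploit the parabolic filtration of AGL_d(F_2),
e.g. averaging over a chain of subgroups each of index poly(n)); B is REFUTED by ¬A-independent
means only together with ¬S, so no unconditional refutation is expected · leaf IDEA-NEEDED · RUNG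
PROVED below it on the dial: |H_n| ≤ poly(n) (`symLift_of_isPBounded_card`, kernel:
`VpFamilyPiCircuit.exists_piCircuit_size_le` + `PICircuit.exists_isSymmetric_of_rename_eval_eq`),
e.g. AGL_k(F_q) with k fixed, n = q^k; by `symLift_anti` B descends to subgroups · NOT an instance
of the refuted RestorationQP shape (that asks all Sym_n-invariant VP families, full Sym_n, qp cost;
refuting witness = CFI-type invariant VP family, which is not per)] If the permanent family is
p-computable over ℂ then for some polynomially bounded t every d admits an AGL_d(F_2)-symmetric
labelled circuit with at most t(2^d) gates com -/
@[route_item "route-ValiantsHypothesis-SymmetryDial", crux]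
def SymLiftAffine : Prop :=
  Literature.Computability.AlgebraicComplexity.IsPComputable (fun n => Literature.Computability.AlgebraicComplexity.perPoly (Fin n) ℂ) → ∃ t : ℕ → ℕ, Literature.Computability.AlgebraicComplexity.IsPBounded t ∧ ∀ d : ℕ, ∃ (G : Type) (_ : Fintype G) (C : Literature.Computability.AlgebraicComplexity.LabelledArithCircuit ℂ ((Fin d → Fin 2) × (Fin d → Fin 2)) Unit G), C.IsSymmetric ↥(Subgroup.closure {σ : Equiv.Perm (Fin d → Fin 2) | ∀ x y z : Fin d → Fin 2, σ (x + y + z) = σ x + σ y + σ z}) ∧ C.eval (C.output ()) = Literature.Computability.AlgebraicComplexity.perPoly (Fin d → Fin 2) ℂ ∧ Fintype.card G ≤ t (2 ^ d)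

/-- item stmt-ValiantsHypothesis-23682 · aside · rank 9 · closed · proved by Summit.ValiantsHypothesis.ValiantsHypothesis.Theorems.SymmetryDialPlumbing.labelledCircuitComplexity_holds (planner) · by planner
sources: Burgisser2000, DawarWilsenach2025
[support] [aside · PROVABLE NOW · plumbing that makes S ⟹ A kernel (`symHardAffine_of_summit` takes
it as hypothesis)] A labelled (Dawar–Wilsenach, unbounded fan-in) arithmetic circuit over ℂ with
gate set G computing f at its output yields a fan-in-two straight-line program for f of length ≤
|G|²: binarise each gate (a gate with m children costs ≤ m−1 ≤ |G| binary operations; inputs and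
constants are free operands). [difficulty: provable-now] -/
@[route_item "route-ValiantsHypothesis-SymmetryDial"]
def LabelledCircuitComplexity : Prop :=
  ∀ (X : Type) (G : Type) [Fintype G] (C : Literature.Computability.AlgebraicComplexity.LabelledArithCircuit ℂ X Unit G), Literature.Computability.AlgebraicComplexity.complexity (C.eval (C.output ())) ≤ Fintype.card G ^ 2

-- `LabelledCircuitComplexity` holds: proved by `Summit.ValiantsHypothesis.ValiantsHypothesis.Theorems.SymmetryDialPlumbing.labelledCircuitComplexity_holds` (its module imports this route file, so no `_holds` link can be stated here).

/-- item stmt-ValiantsHypothesis-23683 · assembly · rank 1 · open · by planner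
sources: Burgisser2000
[assembly] SymHardAffine → SymLiftAffine → ValiantsHypothesis -/
@[route_item "route-ValiantsHypothesis-SymmetryDial"]
def Assembly : Prop :=
  SymHardAffine → SymLiftAffine → _root_.ValiantsHypothesis

/-! D-0027 §2.1 — DECIDING THEOREM (planner-authored via `route open/edit --closes-file`; by planner-decomp-val-lens-1-g2-0 2026-08-29T19:35:54Z):
its hypotheses are this route's items and its conclusion the sub-problem Statement (glue_lint), and it elaborates with this file. -/

@[closes "route-ValiantsHypothesis-SymmetryDial"] theorem closes (hA : SymHardAffine) (hB : SymLiftAffine) : _root_.ValiantsHypothesis := by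
  show Literature.Computability.AlgebraicComplexity.VP ℂ ≠ Literature.Computability.AlgebraicComplexity.VNP ℂ
  intro hEq
  exact hA (hB (Literature.Computability.AlgebraicComplexity.isPComputable_perPoly_complex_iff.mpr hEq))

end Summit.ValiantsHypothesis.ValiantsHypothesis.Theses.SymmetryDial
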